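import Literature.IUT.LogThetaLattice.GlobalLGPFrobenioidsWeightedDiagonal
import Literature.IUT.LogThetaLattice.GlobalLGPFrobenioidsRealifiedPrimes
import Literature.IUT.LogThetaLattice.GlobalFrobenioidModelsTransportTorsor
import Literature.IUT.LogThetaLattice.GlobalFrobenioidModelsTransportDegree
import HarnessLib

/-!
# [IUTchIII] Prop. 3.10 (i) «Kummer isomorphisms of … Frobenioids, and 𝓕⊩-prime-strips» / Prop. 3.10 (iii)
# «(^{n,m}𝓕⊛ℝ_MOD)_α ⥲ 𝓕⊛ℝ_MOD(^{n,∘}𝓗𝓣^𝒟)_α … mutually compatible … with the log-links» AT THE CATEGORY LEVEL: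
# the Kummer transport of the REALIFIED global Frobenioid `(†𝓕⊛ℝ_𝔪𝔬𝔡)_α ≅ (†𝓕⊛ℝ_MOD)_α ≅ †𝒞⊩_LGP` as a FUNCTOR

abc-iut cell, layer L6, seat abc-iut-L6-t5 (gen 6; holder of the cone rows IUTchIII:Prop3.7(i)(iii)(iv), 3.10(i)).
S. Mochizuki, *Inter-universal Teichmüller theory III*, kurims manuscript (May 2020) `paper:url-4b091feeb646`,
§3, Prop. 3.10 (i) p. 147 l. 22 – p. 148 l. 86 and Prop. 3.10 (iii) p. 149 [claim: Mochizuki2012, status: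
disputed] for every quoted sentence; S. Mochizuki, *The geometry of Frobenioids I*, Prop. 5.3 p. 103
[cite: MochizukiFrdI2008, Prop. 5.3 p.103] for the realification.

PRINT. Prop. 3.10 (i) p. 148 l. 26–86: "for each `n, m ∈ ℤ`, we obtain 'Kummer isomorphisms' of fields, monoids,
Frobenioids, and `𝓕⊩`-prime-strips … `(^{n,m}𝓕⊛_MOD)_α ⥲ 𝓕⊛_MOD(^{n,∘}𝓗𝓣^{𝒟-Θ±ellNF})_α` … `^{n,m}𝔉⊩_LGP ⥲
𝔉⊩(^{n,∘}𝓗𝓣^{𝒟-Θ±ellNF})_LGP; ^{n,m}𝔉⊩_lgp ⥲ 𝔉⊩(…)_lgp` that are compatible with the various equalities, natural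
inclusions, and natural isomorphisms discussed above"; Prop. 3.10 (iii) p. 149: these "induce … isomorphisms of
Frobenioids … `(^{n,m}𝓕⊛ℝ_MOD)_α ⥲ 𝓕⊛ℝ_MOD(^{n,∘}𝓗𝓣^{𝒟-Θ±ellNF})_α` that are mutually compatible, as `m` varies over the
elements of `ℤ`, with the log-links".

WHAT THE TREE HAD. At the number-field model of record the Kummer isomorphism of fields `κ_m : K_m ⥲ K_∘`
induces, by the functorial algorithm of Prop. 3.7 (i), the transport `frakTransport (κ m)` (abc-iut-w4-d002,
`GlobalFrobenioidModelsTransport.lean`, p413222): a BIJECTION of the Ex. 3.6 (ii) object types over the model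
places, a FUNCTOR / EQUIVALENCE of abc-iut-L6-t6's integral categories `𝓕⊛_𝔪𝔬𝔡(K_m) ≌ 𝓕⊛_𝔪𝔬𝔡(K_∘)`
(`frakCatEquivalence`, p414241), compatible with the log-links at the object level (`prop310iii_model`) and
with arithmetic degrees (`frakDeg_frakTransport`, p413889 — "the isomorphism of realified CATEGORIES is not
constructed here"). The REALIFIED Frobenioid `(†𝓕⊛ℝ_𝔪𝔬𝔡)_α` (by which the tree also models `†𝒞⊩_LGP`,
`†𝒞⊩_lgp`, the global realified components of the `𝓕⊩`-prime-strips, via abc-iut-L6-t4's weighted-diagonal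
embedding `Prop37.embDiag`, p417019) is abc-iut-w5-d153's category `Prop37.FrakRlfCat F` (p414672/p418367:
objects `(Φ^rlf)^gp = ModelFrakObj F`, morphisms `(n, u)`, `u ∈ ℝ·Φ^birat`).

WHAT THIS FILE ADDS (constructions + theorems; no `Prop`-valued definition, nothing assumed):
* §1 the object-level transport is ADDITIVE (`frakTransport_add/zero/neg/sub/nsmul`) and preserves the
  realified rational function monoid `ℝ·Φ^birat` (`frakTransport_mem_realRatFn_iff`, via Dirichlet
  `mem_realRatFn_iff_frakDeg_eq_zero` + `frakDeg_frakTransport`) and effectivity (`frakTransport_mem_effDiv_iff`);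
* §2 **`FrakRlfCat.transport σ : FrakRlfCat K ⥤ FrakRlfCat K'`** — the Kummer isomorphism of REALIFIED
  Frobenioids induced by an isomorphism of number fields `σ : K ≃+* K'`, `(n, u) ↦ (n, σ_* u)`; it is an
  EQUIVALENCE (indeed isomorphism) of categories **`FrakRlfCat.transportEquivalence σ`** with inverse the
  transport along `σ⁻¹`; faithful, injective on objects, FUNCTORIAL in `σ` (`transport_refl`, `transport_trans`
  as equalities of functors), degree-preserving (`frakDeg_transport_obj`), compatible with the `v`-components /
  local degrees along the correspondence of places (`clsHom_transport_obj`, «compatible with … Prime(−) ⥲ 𝕍»),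
  and COMMUTING WITH THE WEIGHTED-DIAGONAL EMBEDDING (`transport_embDiag`: the Kummer isomorphism of
  `†𝒞⊩_LGP ↪ Π_j (†𝓕⊛ℝ_MOD)_j` is the restriction of the product of the Kummer isomorphisms of the factors —
  "compatible with the various … natural isomorphisms");
* §3 **Prop. 3.10 (iii), second clause, AT THE LEVEL OF REALIFIED CATEGORIES — UNCONDITIONAL at the model**:
  for ANY Kummer column of number fields `κ_m : K_m ⥲ K_∘`, the functors `transport (κ m)` are "mutually
  compatible, as `m` varies over the elements of `ℤ`, with the log-links", the log-link-induced functor being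
  `transport (κ_{m+1}⁻¹ ∘ κ_m)`: **`prop310iii_realified_functor`** (an EQUALITY of functors
  `transport (κ_{m+1}⁻¹ ∘ κ_m) ⋙ transport (κ (m+1)) = transport (κ m)`), whose object-level shadow is
  abc-iut-w4-d002's `prop310iii_model`;
* §4 **`VerticallyCoricGlobalData.ofKummerColumnCat`** — abc-iut-L6-t4's OUTPUT SIGNATURE of Prop. 3.10 (i)
  (`GlobalKummerNonInterference.lean`, p404134) INSTANTIATED with isomorphism types := EQUIVALENCES OF
  CATEGORIES (Frobenioids: abc-iut-L6-t6's `FrakCat` at the model places, Kummer isomorphisms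
  `frakCatEquivalence (κ m)`; global realified components of the `𝓕⊩`-prime-strips: `FrakRlfCat`, Kummer
  isomorphisms `transportEquivalence (κ m)`), upgrading abc-iut-w4-d002's `ofKummerColumn` (p414241; isomorphism
  types = bijections of object types).

HONEST SCOPE. Number-field model of record (all places of the field itself, `Γ_v = ℝ`); the local portions
`†𝔉⊢_LGP = Ψ_{𝓕LGP}` of the strips and their Kummer isomorphisms are abc-iut-L6-t4's Prop. 3.5 (i) data
(`VerticallyCoricLGPData.kummer`) and are not re-typed here; print IDENTIFIES `(†𝓕⊛_mod)_α`, `(†𝓕⊛_𝔪𝔬𝔡)_α`,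
`(†𝓕⊛_MOD)_α` along Prop. 3.7 (i)(ii) ("We shall often use this isomorphism of Frobenioids to identify") and so
does §4 (the tree's distinct models and their equivalences are `Prop37.isoFrakMod`, `Prop37.isoFrakMODCat`,
`GlobalFrobenioidModels.toMOD`). Nothing here asserts a disputed claim or takes a side on [IUTchIII] Cor. 3.12;
typed ≠ discharged; instantiated ≠ endorsed.
-/

noncomputable section

namespace Literature.IUT.LogThetaLattice

open CategoryTheory NumberField

/-! ### §1 The object-level Kummer transport is additive and preserves `ℝ·Φ^birat` and effectivity -/

namespace GlobalFrobenioidModels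

variable {K K' : Type} [Field K] [NumberField K] [Field K'] [NumberField K']

omit [NumberField K'] in
/-- `σ_*(𝔍₁ + 𝔍₂) = σ_* 𝔍₁ + σ_* 𝔍₂` ("compatible with the various equalities … natural isomorphisms": the Kummer
transport respects tensor products of families). ([IUTchIII] Prop 3.10 (i) p.148) [claim: Mochizuki2012, status: disputed] -/
@[simp] theorem frakTransport_add (σ : K ≃+* K') (J₁ J₂ : ModelFrakObj K) :
    frakTransport σ (J₁ + J₂) = frakTransport σ J₁ + frakTransport σ J₂ :=
  FrakObj.ext_cls rfl

omit [NumberField K'] in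
/-- `σ_* 𝒪 = 𝒪`. ([IUTchIII] Prop 3.10 (i) p.148) [claim: Mochizuki2012, status: disputed] -/
@[simp] theorem frakTransport_zero (σ : K ≃+* K') : frakTransport σ (0 : ModelFrakObj K) = 0 :=
  FrakObj.ext_cls rfl

omit [NumberField K'] in
/-- `σ_*(𝔍^{⊗(-1)}) = (σ_* 𝔍)^{⊗(-1)}`. ([IUTchIII] Prop 3.10 (i) p.148) [claim: Mochizuki2012, status: disputed] -/
@[simp] theorem frakTransport_neg (σ : K ≃+* K') (J : ModelFrakObj K) :
    frakTransport σ (-J) = -frakTransport σ J :=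
  FrakObj.ext_cls rfl

omit [NumberField K'] in
/-- `σ_*(𝔍₁ − 𝔍₂) = σ_* 𝔍₁ − σ_* 𝔍₂`. ([IUTchIII] Prop 3.10 (i) p.148) [claim: Mochizuki2012, status: disputed] -/
@[simp] theorem frakTransport_sub (σ : K ≃+* K') (J₁ J₂ : ModelFrakObj K) :
    frakTransport σ (J₁ - J₂) = frakTransport σ J₁ - frakTransport σ J₂ :=
  FrakObj.ext_cls rfl

omit [NumberField K'] in
/-- `σ_*(𝔍^{⊗n}) = (σ_* 𝔍)^{⊗n}`. ([IUTchIII] Prop 3.10 (i) p.148) [claim: Mochizuki2012, status: disputed] -/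
@[simp] theorem frakTransport_nsmul (σ : K ≃+* K') (n : ℕ) (J : ModelFrakObj K) :
    frakTransport σ (n • J) = n • frakTransport σ J :=
  FrakObj.ext_cls (funext fun v' => by
    simp only [frakTransport_apply, FrakObj.reindex_cls, FrakObj.cls_nsmul])

/-- **The transport preserves the rational function monoid `ℝ·Φ^birat` of the realification** ([FrdI] Prop.
5.3): `σ_* u ∈ ℝ·Φ^birat(K') ↔ u ∈ ℝ·Φ^birat(K)` — by Dirichlet (`mem_realRatFn_iff_frakDeg_eq_zero`,
abc-iut-w5-d153) and `deg(σ_* u) = deg u` (abc-iut-w4-d002). ([IUTchIII] Prop 3.10 (iii) p.149)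
[claim: Mochizuki2012, status: disputed] -/
theorem frakTransport_mem_realRatFn_iff (σ : K ≃+* K') (u : ModelFrakObj K) :
    frakTransport σ u ∈ Prop37.realRatFn K' ↔ u ∈ Prop37.realRatFn K := by
  rw [Prop37.mem_realRatFn_iff_frakDeg_eq_zero, Prop37.mem_realRatFn_iff_frakDeg_eq_zero,
    frakDeg_frakTransport]

omit [NumberField K'] in
/-- **The transport preserves effectivity**: `σ_* D ∈ Φ^rlf(K') ↔ D ∈ Φ^rlf(K)` (the cones `Γ_v^{≥0} = ℝ_{≥0}`
correspond under the bijection of places, `nonnegModel_placesEquiv`). ([IUTchIII] Prop 3.10 (i) p.148)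
[claim: Mochizuki2012, status: disputed] -/
theorem frakTransport_mem_effDiv_iff (σ : K ≃+* K') (D : ModelFrakObj K) :
    frakTransport σ D ∈ effDiv (ModelPlaces K') (fun _ => ℝ) nonnegModel ↔
      D ∈ effDiv (ModelPlaces K) (fun _ => ℝ) nonnegModel := by
  rw [mem_effDiv, mem_effDiv]
  constructor
  · intro h v
    have hv := h (placesEquiv σ v)
    rwa [frakTransport_apply, FrakObj.reindex_cls, Equiv.symm_apply_apply] at hv
  · intro h v'
    rw [frakTransport_apply, FrakObj.reindex_cls]
    exact h _

omit [NumberField K'] in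
/-- The `v`-component of the transported family at the corresponding place `σ v` is the `v`-component
(«compatible with … Prime(−) ⥲ 𝕍»: the transport is the identity on local degrees read along
`placesEquiv σ`). ([IUTchIII] Prop 3.10 (i) p.148) [claim: Mochizuki2012, status: disputed] -/
@[simp] theorem cls_frakTransport_placesEquiv (σ : K ≃+* K') (J : ModelFrakObj K) (v : ModelPlaces K) :
    (frakTransport σ J).cls (placesEquiv σ v) = J.cls v := by
  rw [frakTransport_apply, FrakObj.reindex_cls, Equiv.symm_apply_apply]

omit [NumberField K'] in
/-- `σ⁻¹_*(σ_* 𝔍) = 𝔍`. ([IUTchIII] Prop 3.10 (i) p.148) [claim: Mochizuki2012, status: disputed] -/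
@[simp] theorem frakTransport_symm_frakTransport (σ : K ≃+* K') (J : ModelFrakObj K) :
    frakTransport σ.symm (frakTransport σ J) = J := by
  rw [← frakTransport_symm, Equiv.symm_apply_apply]

omit [NumberField K] in
/-- `σ_*(σ⁻¹_* 𝔍') = 𝔍'`. ([IUTchIII] Prop 3.10 (i) p.148) [claim: Mochizuki2012, status: disputed] -/
@[simp] theorem frakTransport_frakTransport_symm (σ : K ≃+* K') (J' : ModelFrakObj K') :
    frakTransport σ (frakTransport σ.symm J') = J' := by
  rw [← frakTransport_symm, Equiv.apply_symm_apply]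

end GlobalFrobenioidModels

/-! ### §2 The Kummer transport of the realified Frobenioid `(†𝓕⊛ℝ_𝔪𝔬𝔡)_α` as a functor -/

namespace Prop37

namespace FrakRlfCat

open GlobalFrobenioidModels

variable {K K' K'' : Type} [Field K] [NumberField K] [Field K'] [NumberField K'] [Field K''] [NumberField K'']

omit [NumberField K'] in
/-- Bookkeeping: `σ_*(u + n•X − Y) = σ_* u + n•σ_* X − σ_* Y`. ([IUTchIII] Prop 3.10 (i) p.148)
[claim: Mochizuki2012, status: disputed] -/
theorem frakTransport_homExpr (σ : K ≃+* K') (u X Y : ModelFrakObj K) (n : ℕ) :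
    frakTransport σ (u + n • X - Y) = frakTransport σ u + n • frakTransport σ X - frakTransport σ Y := by
  rw [frakTransport_sub, frakTransport_add, frakTransport_nsmul]

/-- **The Kummer isomorphism of REALIFIED Frobenioids `(^{n,m}𝓕⊛ℝ_MOD)_α ⥲ 𝓕⊛ℝ_MOD(^{n,∘}𝓗𝓣^𝒟)_α` as a FUNCTOR**
`(†𝓕⊛ℝ_𝔪𝔬𝔡)(K) ⥤ (†𝓕⊛ℝ_𝔪𝔬𝔡)(K')` induced by an isomorphism of number fields `σ : K ≃+* K'` (the Kummer
isomorphism of fields of Prop. 3.10 (i)): objects `α ↦ σ_* α`, morphisms `(n, u) ↦ (n, σ_* u)` — the realification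
([FrdI] Prop. 5.3) of the functorial algorithm of Prop. 3.7 (i) (`frakCatTransport`). ([IUTchIII] Prop 3.10 (iii) p.149)
[claim: Mochizuki2012, status: disputed] -/
def transport (σ : K ≃+* K') : FrakRlfCat K ⥤ FrakRlfCat K' where
  obj X := FrakRlfCat.of (frakTransport σ X.obj)
  map {X Y} φ := FrakRlfCat.homMk (FrakRlfCat.deg φ) (frakTransport σ (FrakRlfCat.fn φ))
    ((frakTransport_mem_realRatFn_iff σ _).mpr (FrakRlfCat.fn_mem φ)) (by
      rw [show frakTransport σ (FrakRlfCat.fn φ) + (FrakRlfCat.deg φ : ℕ) • (FrakRlfCat.of (frakTransport σ X.obj)).obj -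
          (FrakRlfCat.of (frakTransport σ Y.obj)).obj =
          frakTransport σ (FrakRlfCat.fn φ + (FrakRlfCat.deg φ : ℕ) • X.obj - Y.obj) by
        rw [FrakRlfCat.obj_of, FrakRlfCat.obj_of, frakTransport_homExpr]]
      exact (frakTransport_mem_effDiv_iff σ _).mpr (FrakRlfCat.eff_mem φ))
  map_id X := FrakRlfCat.hom_ext rfl (by
    show frakTransport σ (FrakRlfCat.fn (𝟙 X)) = 0
    rw [FrakRlfCat.fn_id, frakTransport_zero])
  map_comp {X Y Z} φ ψ := FrakRlfCat.hom_ext rfl (by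
    show frakTransport σ (FrakRlfCat.fn (φ ≫ ψ)) =
      frakTransport σ (FrakRlfCat.fn ψ) + (FrakRlfCat.deg ψ : ℕ) • frakTransport σ (FrakRlfCat.fn φ)
    rw [FrakRlfCat.fn_comp, frakTransport_add, frakTransport_nsmul])

/-- `transport σ` on objects is `σ_*` (definitional). ([IUTchIII] Prop 3.10 (i) p.148) [claim: Mochizuki2012, status: disputed] -/
@[simp] theorem transport_obj_obj (σ : K ≃+* K') (X : FrakRlfCat K) :
    ((transport σ).obj X).obj = frakTransport σ X.obj := rfl

/-- `transport σ` preserves Frobenius degrees (definitional). ([IUTchIII] Prop 3.10 (i) p.148) [claim: Mochizuki2012, status: disputed] -/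
@[simp] theorem deg_transport_map (σ : K ≃+* K') {X Y : FrakRlfCat K} (φ : X ⟶ Y) :
    FrakRlfCat.deg ((transport σ).map φ) = FrakRlfCat.deg φ := rfl

/-- `transport σ` on rational functions is `σ_*` (definitional). ([IUTchIII] Prop 3.10 (i) p.148) [claim: Mochizuki2012, status: disputed] -/
@[simp] theorem fn_transport_map (σ : K ≃+* K') {X Y : FrakRlfCat K} (φ : X ⟶ Y) :
    FrakRlfCat.fn ((transport σ).map φ) = frakTransport σ (FrakRlfCat.fn φ) := rfl

/-- The Kummer transport of realified Frobenioids is injective on objects. ([IUTchIII] Prop 3.10 (i) p.148)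
[claim: Mochizuki2012, status: disputed] -/
theorem transport_obj_injective (σ : K ≃+* K') : Function.Injective (transport σ).obj := fun X Y h => by
  have h' : frakTransport σ X.obj = frakTransport σ Y.obj := congrArg FrakRlfCat.obj h
  rw [← FrakRlfCat.of_obj X, ← FrakRlfCat.of_obj Y, (frakTransport σ).injective h']

/-- The Kummer transport of realified Frobenioids is faithful. ([IUTchIII] Prop 3.10 (i) p.148)
[claim: Mochizuki2012, status: disputed] -/
theorem transport_faithful (σ : K ≃+* K') : (transport σ).Faithful :=
  ⟨fun {X Y} φ ψ h => FrakRlfCat.hom_ext (by simpa using congrArg FrakRlfCat.deg h)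
    ((frakTransport σ).injective (by simpa using congrArg FrakRlfCat.fn h))⟩

/-- The Frobenius degree of an `eqToHom` in `(†𝓕⊛ℝ_𝔪𝔬𝔡)_α` is `1`. [cite: MochizukiFrdI2008, Thm. 5.2 p.100] -/
theorem deg_eqToHom {X Y : FrakRlfCat K} (h : X = Y) : FrakRlfCat.deg (eqToHom h) = 1 := by
  subst h
  rfl

/-- The rational function of an `eqToHom` in `(†𝓕⊛ℝ_𝔪𝔬𝔡)_α` is `0`. [cite: MochizukiFrdI2008, Thm. 5.2 p.100] -/
theorem fn_eqToHom {X Y : FrakRlfCat K} (h : X = Y) : FrakRlfCat.fn (eqToHom h) = 0 := by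
  subst h
  rfl

/-- **FUNCTORIALITY, identities**: the transport along `id_K` IS the identity functor. ([IUTchIII] Prop 3.10 (i) p.148)
[claim: Mochizuki2012, status: disputed] -/
theorem transport_refl : transport (RingEquiv.refl K) = 𝟭 (FrakRlfCat K) := by
  refine CategoryTheory.Functor.ext (fun X => ?_) (fun X Y φ => ?_)
  · show FrakRlfCat.of (frakTransport (RingEquiv.refl K) X.obj) = X
    rw [frakTransport_refl, Equiv.refl_apply, FrakRlfCat.of_obj]
  · apply FrakRlfCat.hom_ext
    · simp [deg_eqToHom]
    · simp [fn_eqToHom, deg_eqToHom]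

omit [NumberField K''] in
/-- **FUNCTORIALITY, composition**: transport along `σ` then `τ` IS transport along `σ.trans τ` (an equality of
functors) — the hypothesis `hΦ` of abc-iut-w4-d002's `Prop310iii_compatible_of_functorialAlgorithm`, now for
the realified CATEGORIES. ([IUTchIII] Prop 3.10 (i) p.148; Rmk 3.10.1 (i) p.149) [claim: Mochizuki2012, status: disputed] -/
theorem transport_trans [NumberField K''] (σ : K ≃+* K') (τ : K' ≃+* K'') :
    transport (σ.trans τ) = transport σ ⋙ transport τ := by
  refine CategoryTheory.Functor.ext (fun X => ?_) (fun X Y φ => ?_)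
  · show FrakRlfCat.of (frakTransport (σ.trans τ) X.obj) =
      FrakRlfCat.of (frakTransport τ (frakTransport σ X.obj))
    rw [frakTransport_trans, Equiv.trans_apply]
  · apply FrakRlfCat.hom_ext
    · simp [deg_eqToHom]
    · simp [fn_eqToHom, deg_eqToHom, frakTransport_trans]

/-- **The Kummer isomorphism of realified Frobenioids is an EQUIVALENCE (indeed isomorphism) of categories**
`(†𝓕⊛ℝ_𝔪𝔬𝔡)(K) ≌ (†𝓕⊛ℝ_𝔪𝔬𝔡)(K')`, inverse = transport along `σ⁻¹`, unit and counit identities (`eqToIso`).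
([IUTchIII] Prop 3.10 (i) p.148; Prop 3.10 (iii) p.149) [claim: Mochizuki2012, status: disputed] -/
def transportEquivalence (σ : K ≃+* K') : FrakRlfCat K ≌ FrakRlfCat K' :=
  CategoryTheory.Equivalence.mk (transport σ) (transport σ.symm)
    (NatIso.ofComponents
      (fun X => eqToIso (by
        change X = FrakRlfCat.of (frakTransport σ.symm (frakTransport σ X.obj))
        rw [← frakTransport_symm, Equiv.symm_apply_apply, FrakRlfCat.of_obj]))
      (fun {X Y} φ => by
        apply FrakRlfCat.hom_ext
        · simp [deg_eqToHom]
        · simp [fn_eqToHom, deg_eqToHom, -frakTransport_apply]))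
    (NatIso.ofComponents
      (fun X' => eqToIso (by
        change FrakRlfCat.of (frakTransport σ (frakTransport σ.symm X'.obj)) = X'
        rw [← frakTransport_symm, Equiv.apply_symm_apply, FrakRlfCat.of_obj]))
      (fun {X' Y'} φ => by
        apply FrakRlfCat.hom_ext
        · simp [deg_eqToHom]
        · simp [fn_eqToHom, deg_eqToHom, -frakTransport_apply]))

/-- The functor of `transportEquivalence σ` is `transport σ` (definitional). ([IUTchIII] Prop 3.10 (i) p.148)
[claim: Mochizuki2012, status: disputed] -/
@[simp] theorem transportEquivalence_functor (σ : K ≃+* K') :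
    (transportEquivalence σ).functor = transport σ := rfl

/-- The inverse of `transportEquivalence σ` is `transport σ⁻¹` (definitional). ([IUTchIII] Prop 3.10 (i) p.148)
[claim: Mochizuki2012, status: disputed] -/
@[simp] theorem transportEquivalence_inverse (σ : K ≃+* K') :
    (transportEquivalence σ).inverse = transport σ.symm := rfl

/-- `transport σ` is an equivalence of categories. ([IUTchIII] Prop 3.10 (i) p.148) [claim: Mochizuki2012, status: disputed] -/
theorem transport_isEquivalence (σ : K ≃+* K') : (transport σ).IsEquivalence :=
  (transportEquivalence σ).isEquivalence_functor

/-- **Compatibility with arithmetic degrees / global log-volumes**: `deg(σ_* α) = deg α` on objects of the realified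
Frobenioid (abc-iut-w4-d002's `frakDeg_frakTransport`; Prop. 3.9 (iii) "global log-volume = degree"), so the
Kummer isomorphism of realified Frobenioids respects the classification of isomorphism classes by the degree
(abc-iut-w5-d153's `isoOfFrakDegEq`). ([IUTchIII] Prop 3.10 (iii) p.149) [claim: Mochizuki2012, status: disputed] -/
theorem frakDeg_transport_obj (σ : K ≃+* K') (X : FrakRlfCat K) :
    frakDeg ((transport σ).obj X).obj = frakDeg X.obj :=
  frakDeg_frakTransport σ X.obj

/-- The degree of the rational function of a transported morphism is unchanged (it is `0` on both sides:
`ℝ·Φ^birat` = degree-zero families). ([IUTchIII] Prop 3.10 (iii) p.149) [claim: Mochizuki2012, status: disputed] -/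
theorem frakDeg_fn_transport_map (σ : K ≃+* K') {X Y : FrakRlfCat K} (φ : X ⟶ Y) :
    frakDeg (FrakRlfCat.fn ((transport σ).map φ)) =
      frakDeg (FrakRlfCat.fn φ) :=
  frakDeg_frakTransport σ _

/-- **Compatibility with `Prime(−) ⥲ 𝕍` / the local degrees**: the `σ v`-component of the transported object is
the `v`-component of the object (abc-iut-w5-d153's `clsHom`, the `v`-component of `(Φ^rlf)^gp(∗) = ⊕'_v ℝ`).
([IUTchIII] Prop 3.10 (i) p.148) [claim: Mochizuki2012, status: disputed] -/
theorem clsHom_transport_obj (σ : K ≃+* K') (X : FrakRlfCat K) (v : ModelPlaces K) :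
    clsHom K' (placesEquiv σ v) ((transport σ).obj X).obj = clsHom K v X.obj := by
  rw [clsHom_apply, clsHom_apply, transport_obj_obj, cls_frakTransport_placesEquiv]

/-- **Compatibility with the weighted-diagonal embedding `†𝒞⊩_LGP ↪ Π_j (†𝓕⊛ℝ_MOD)_j`** (Prop. 3.7 (iii)/(v),
abc-iut-L6-t4's `embDiag`; [IUTchII] Rmk. 4.5.4 weights `j²`), on objects: transporting the `j`-th component
`j²·α` is the `j`-th component of the transported object — the Kummer isomorphism of `†𝒞⊩_LGP` IS the
restriction of the product of the Kummer isomorphisms of the factors. ([IUTchIII] Prop 3.10 (i) p.148)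
[claim: Mochizuki2012, status: disputed] -/
theorem transport_embDiag_obj (σ : K ≃+* K') {lstar : ℕ} (X : FrakRlfCat K) (i : Fin lstar) :
    (transport σ).obj ((embDiag K lstar).obj X i) = (embDiag K' lstar).obj ((transport σ).obj X) i := by
  show FrakRlfCat.of (frakTransport σ (sqWt i • X.obj)) = FrakRlfCat.of (sqWt i • frakTransport σ X.obj)
  rw [frakTransport_nsmul]

/-- Compatibility with the weighted-diagonal embedding on morphisms: same Frobenius degree … ([IUTchIII] Prop 3.10 (i) p.148)
[claim: Mochizuki2012, status: disputed] -/
theorem deg_transport_embDiag_map (σ : K ≃+* K') {lstar : ℕ} {X Y : FrakRlfCat K} (φ : X ⟶ Y) (i : Fin lstar) :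
    FrakRlfCat.deg ((transport σ).map ((embDiag K lstar).map φ i)) =
      FrakRlfCat.deg ((embDiag K' lstar).map ((transport σ).map φ) i) := rfl

/-- … and the same rational function `σ_*(j²·u) = j²·σ_* u`. ([IUTchIII] Prop 3.10 (i) p.148)
[claim: Mochizuki2012, status: disputed] -/
theorem fn_transport_embDiag_map (σ : K ≃+* K') {lstar : ℕ} {X Y : FrakRlfCat K} (φ : X ⟶ Y) (i : Fin lstar) :
    FrakRlfCat.fn ((transport σ).map ((embDiag K lstar).map φ i)) =
      FrakRlfCat.fn ((embDiag K' lstar).map ((transport σ).map φ) i) := by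
  rw [fn_transport_map, fn_embDiag_map, fn_embDiag_map, fn_transport_map, frakTransport_nsmul]

/-! ### §3 [IUTchIII] Prop. 3.10 (iii) for the REALIFIED Frobenioids, at the level of categories -/

section KummerColumn

variable {Kf : ℤ → Type} [∀ m, Field (Kf m)] [∀ m, NumberField (Kf m)] {Kc : Type} [Field Kc] [NumberField Kc]

/-- **The Kummer isomorphism of realified Frobenioids at `(n, m)`** — `(^{n,m}𝓕⊛ℝ_MOD)_α ⥲ 𝓕⊛ℝ_MOD(^{n,∘}𝓗𝓣^𝒟)_α`,
equivalently (under abc-iut-L6-t4's weighted-diagonal model, `transport_embDiag_obj`) the global realified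
component of `^{n,m}𝔉⊩_LGP ⥲ 𝔉⊩(^{n,∘}𝓗𝓣^𝒟)_LGP` — induced by the Kummer isomorphism of fields `κ_m : K_m ⥲ K_∘` of
Prop. 3.10 (i), as an equivalence of categories. ([IUTchIII] Prop 3.10 (i) p.148; (iii) p.149)
[claim: Mochizuki2012, status: disputed] -/
def kummerRlf (κ : ∀ m, Kf m ≃+* Kc) (m : ℤ) : FrakRlfCat (Kf m) ≌ FrakRlfCat Kc :=
  transportEquivalence (κ m)

/-- The log-link-induced functor of realified Frobenioids `(^{n,m}𝓕⊛ℝ) ⥤ (^{n,m+1}𝓕⊛ℝ)`: transport along the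
log-Kummer field identification `κ_{m+1}⁻¹ ∘ κ_m` (the route "through the vertically coric copy" of Prop. 3.10
(ii); abc-iut-w4-d002's `prop310iii_model_lg_eq` shows it is the ONLY compatible choice on objects).
([IUTchIII] Prop 3.10 (iii) p.149; Rmk 3.10.1 (i) p.149) [claim: Mochizuki2012, status: disputed] -/
def logLinkRlf (κ : ∀ m, Kf m ≃+* Kc) (m : ℤ) : FrakRlfCat (Kf m) ⥤ FrakRlfCat (Kf (m + 1)) :=
  transport ((κ m).trans (κ (m + 1)).symm)

/-- **[IUTchIII] Prop. 3.10 (iii), the REALIFIED display, AS FUNCTORS — UNCONDITIONAL at the model**: for ANY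
column of Kummer isomorphisms of number fields `κ_m : K_m ⥲ K_∘`, the Kummer isomorphisms of realified Frobenioids
`(^{n,m}𝓕⊛ℝ_MOD)_α ⥲ 𝓕⊛ℝ_MOD(^{n,∘}𝓗𝓣^𝒟)_α` are "mutually compatible, as `m` varies over the elements of `ℤ`, with the
log-links": following the log-link `(n,m) → (n,m+1)` and then the Kummer isomorphism at `m+1` IS the Kummer
isomorphism at `m` — an EQUALITY OF FUNCTORS (objects AND morphisms `(deg, u)`), by functoriality of the
transport alone (Rmk. 3.10.1 (i) "precisely because the construction … only involves the [field]"). The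
object-level shadow is abc-iut-w4-d002's `prop310iii_model` (p413222). ([IUTchIII] Prop 3.10 (iii) p.149)
[claim: Mochizuki2012, status: disputed] -/
theorem prop310iii_realified_functor (κ : ∀ m, Kf m ≃+* Kc) (m : ℤ) :
    logLinkRlf κ m ⋙ (kummerRlf κ (m + 1)).functor = (kummerRlf κ m).functor := by
  rw [kummerRlf, kummerRlf, transportEquivalence_functor, transportEquivalence_functor, logLinkRlf,
    ← transport_trans]
  congr 1
  ext x
  simp

omit [NumberField Kc] in
/-- The same compatibility in abc-iut-L6-t4's typed currency `Prop310iii_compatible` (`GlobalKummerNonInterference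
.lean`, p404134) for the OBJECTS of the realified categories: it is literally abc-iut-w4-d002's
`prop310iii_model` (the object type of `FrakRlfCat` is `ModelFrakObj`). ([IUTchIII] Prop 3.10 (iii) p.149)
[claim: Mochizuki2012, status: disputed] -/
theorem prop310iii_realified_obj (κ : ∀ m, Kf m ≃+* Kc) :
    Literature.IUT.LogThetaLattice.Prop310iii_compatible (fun m => FrakRlfCat (Kf m))
      (fun m => ((frakTransport (κ m) : ModelFrakObj (Kf m) ≃ ModelFrakObj Kc) :
        FrakRlfCat (Kf m) ≃ FrakRlfCat Kc))
      (fun m => (logLinkRlf κ m).obj) :=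
  prop310iii_model κ

/-- Along the family, degrees (= global log-volumes, Prop. 3.9 (iii)) are constant: both the Kummer functors and
the log-link functors preserve `frakDeg` on objects. ([IUTchIII] Prop 3.10 (iii) p.149) [claim: Mochizuki2012, status: disputed] -/
theorem frakDeg_kummerRlf_logLinkRlf (κ : ∀ m, Kf m ≃+* Kc) (m : ℤ) (X : FrakRlfCat (Kf m)) :
    frakDeg (((kummerRlf κ m).functor.obj X).obj) = frakDeg X.obj ∧
      frakDeg (((logLinkRlf κ m).obj X).obj) = frakDeg X.obj :=
  ⟨frakDeg_transport_obj (κ m) X, frakDeg_transport_obj _ X⟩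

end KummerColumn

end FrakRlfCat

end Prop37

/-! ### §4 The output signature of Prop. 3.10 (i) instantiated with EQUIVALENCES OF CATEGORIES -/

namespace GlobalFrobenioidModels

variable {Kf : ℤ → Type} [∀ m, Field (Kf m)] [∀ m, NumberField (Kf m)] {Kc : Type} [Field Kc] [NumberField Kc]

/-- The integral model Frobenioid `𝓕⊛_𝔪𝔬𝔡 ≅ 𝓕⊛_mod ≅ 𝓕⊛_MOD` (abc-iut-L6-t6's `FrakCat` at the model places, `Γ_v = ℝ`)
attached to an index of the Kummer column `ℤ ⊔ {∘}`, as an object of Mathlib's `Cat`. ([IUTchIII] Prop 3.10 (i) p.147)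
[claim: Mochizuki2012, status: disputed] -/
def columnFrakCat (Kf : ℤ → Type) [∀ m, Field (Kf m)] [∀ m, NumberField (Kf m)] (Kc : Type) [Field Kc]
    [NumberField Kc] : ColumnIndex.{0} → Cat.{0, 0}
  | ⟨Sum.inl m⟩ => Cat.of (FrakCat (Kf m) (ModelPlaces (Kf m)) (fun _ => ℝ) nonnegModel betaModel)
  | ⟨Sum.inr _⟩ => Cat.of (FrakCat Kc (ModelPlaces Kc) (fun _ => ℝ) nonnegModel betaModel)

/-- The REALIFIED model Frobenioid `(𝓕⊛ℝ_𝔪𝔬𝔡)` — by which the tree models the global realified component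
`𝒞⊩_LGP ≅ 𝒞⊩_lgp ≅ 𝒞⊩_gau` of the `𝓕⊩`-prime-strips (abc-iut-L6-t4's `embDiag`) — attached to an index of the
column, as an object of `Cat`. ([IUTchIII] Prop 3.10 (i) p.147) [claim: Mochizuki2012, status: disputed] -/
def columnRlfCat (Kf : ℤ → Type) [∀ m, Field (Kf m)] [∀ m, NumberField (Kf m)] (Kc : Type) [Field Kc]
    [NumberField Kc] : ColumnIndex.{0} → Cat.{0, 0}
  | ⟨Sum.inl m⟩ => Cat.of (Prop37.FrakRlfCat (Kf m))
  | ⟨Sum.inr _⟩ => Cat.of (Prop37.FrakRlfCat Kc)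

/-- **The OUTPUT SIGNATURE of [IUTchIII] Prop. 3.10 (i) (abc-iut-L6-t4's `VerticallyCoricGlobalData`) INSTANTIATED
by a Kummer column of number fields with isomorphism types := EQUIVALENCES OF CATEGORIES**: `Mfrob m := K_m`,
`Mcoric := K_∘`, `kummerField := κ_m`; Frobenioids = the integral model categories `columnFrakCat`, Kummer
isomorphisms of Frobenioids := abc-iut-w4-d002's `frakCatEquivalence (κ m)`; strips (global realified component)
= `columnRlfCat`, Kummer isomorphisms of strips := `Prop37.FrakRlfCat.transportEquivalence (κ m)`; the natural
isomorphisms `𝓕⊛_mod ≅ 𝓕⊛_𝔪𝔬𝔡 ≅ 𝓕⊛_MOD`, `𝔉⊩_gau ≅ 𝔉⊩_LGP ≅ 𝔉⊩_lgp` := identity equivalences of the identified model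
(print p. 110 l. 22 "identify"; the tree's distinct models are related by `Prop37.isoFrakMod`,
`Prop37.isoFrakMODCat`, `toMOD`). Upgrades abc-iut-w4-d002's `VerticallyCoricGlobalData.ofKummerColumn` (p414241:
isomorphism types = bijections of object types). ([IUTchIII] Prop 3.10 (i) p.147) [claim: Mochizuki2012, status: disputed] -/
def VerticallyCoricGlobalData.ofKummerColumnCat (lstar : ℕ) (κ : ∀ m, Kf m ≃+* Kc) :
    VerticallyCoricGlobalData lstar ColumnIndex.{0}
      (fun A B => (columnFrakCat Kf Kc A : Type) ≌ (columnFrakCat Kf Kc B : Type)) ColumnIndex.{0}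
      (fun A B => (columnRlfCat Kf Kc A : Type) ≌ (columnRlfCat Kf Kc B : Type)) where
  Mcoric _ := Kc
  Mfrob m _ := Kf m
  kummerField m _ := κ m
  Fmod _ := ⟨Sum.inr ()⟩
  Ffrak _ := ⟨Sum.inr ()⟩
  FMOD _ := ⟨Sum.inr ()⟩
  isoModFrak _ := CategoryTheory.Equivalence.refl
  isoFrakMOD _ := CategoryTheory.Equivalence.refl
  FMODfrob m _ := ⟨Sum.inl m⟩
  kummerFMOD m _ := frakCatEquivalence (κ m)
  Sgau := ⟨Sum.inr ()⟩
  SLGP := ⟨Sum.inr ()⟩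
  Slgp := ⟨Sum.inr ()⟩
  isoGauLGP := CategoryTheory.Equivalence.refl
  isoLGPlgp := CategoryTheory.Equivalence.refl
  SLGPfrob m := ⟨Sum.inl m⟩
  kummerSLGP m := Prop37.FrakRlfCat.transportEquivalence (κ m)

/-- The Kummer isomorphisms of Frobenioids of the categorical instance ARE abc-iut-w4-d002's equivalences
`frakCatEquivalence (κ m)` (definitional). ([IUTchIII] Prop 3.10 (i) p.148) [claim: Mochizuki2012, status: disputed] -/
theorem VerticallyCoricGlobalData.ofKummerColumnCat_kummerFMOD (lstar : ℕ) (κ : ∀ m, Kf m ≃+* Kc) (m : ℤ)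
    (j : Fin lstar) :
    (VerticallyCoricGlobalData.ofKummerColumnCat lstar κ).kummerFMOD m j = frakCatEquivalence (κ m) := rfl

/-- The Kummer isomorphisms of (the global realified components of) the `𝓕⊩`-prime-strips of the categorical
instance ARE the realified transports `transportEquivalence (κ m)` (definitional). ([IUTchIII] Prop 3.10 (i) p.148)
[claim: Mochizuki2012, status: disputed] -/
theorem VerticallyCoricGlobalData.ofKummerColumnCat_kummerSLGP (lstar : ℕ) (κ : ∀ m, Kf m ≃+* Kc) (m : ℤ) :
    (VerticallyCoricGlobalData.ofKummerColumnCat lstar κ).kummerSLGP m =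
      Prop37.FrakRlfCat.transportEquivalence (κ m) := rfl

/-- **Closing the loop at the category level** ([IUTchIII] Prop. 3.10 (iii), second display, for the categorical
instance of the Prop. 3.10 (i) signature): the strip Kummer isomorphisms `kummerSLGP m` of `ofKummerColumnCat` are
mutually compatible with the log-link functors `logLinkRlf κ m` AS FUNCTORS (`prop310iii_realified_functor`).
([IUTchIII] Prop 3.10 (iii) p.149) [claim: Mochizuki2012, status: disputed] -/
theorem VerticallyCoricGlobalData.ofKummerColumnCat_compatible (lstar : ℕ) (κ : ∀ m, Kf m ≃+* Kc) (m : ℤ) :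
    Prop37.FrakRlfCat.logLinkRlf κ m ⋙
        ((VerticallyCoricGlobalData.ofKummerColumnCat lstar κ).kummerSLGP (m + 1)).functor =
      ((VerticallyCoricGlobalData.ofKummerColumnCat lstar κ).kummerSLGP m).functor :=
  Prop37.FrakRlfCat.prop310iii_realified_functor κ m

end GlobalFrobenioidModels

end Literature.IUT.LogThetaLattice
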